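import Summits.BirchSwinnertonDyer.BirchSwinnertonDyer.Theorems.PrintX11aLowerHalfThreeKodairaMember
import Literature.NumberTheory.EllipticCurves.CongruentNewformLevelAdditivePrimes
import HarnessLib

/-!
# Crux `X11aLowerHalf` (item stmt-BirchSwinnertonDyer-19064), `p = 3`: the registered stub `stub_memberRatEqAtThree`
# RESTRICTED TO THE KODAIRA SUB-LOCUS, and the lower half there, FROM NAMED PUBLISHED FACTS ALONE — the displayed
# Carayol–Livné lower bound of `PrintX11aLowerHalfThreeKodairaMember` discharged BY NAME from the Literature fact
# `carayolLivne_additivePrime_dvd_level_of_congruent_newform`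
# (`--supports stmt-BirchSwinnertonDyer-19064` helper; seat bsd-line-er5-p2 = -w3 width seat of the 19064 line)

HONEST FRAMING. Theorems only; no definition, no named fact, no `sorry`; NO route file imported. CONDITIONAL on
displayed named facts — among them Skinner–Urban's member instance (FLAG `SU14-12.3.6-mu@nonsplit@3`, ACTIVE-PRINT-GAP
at `p = 3`, exactly as in p617929) and the Carayol–Livné lower bound at an additive prime
(`Literature/NumberTheory/EllipticCurves/CongruentNewformLevelAdditivePrimes.lean`). Closes nothing class-wide: the
sub-locus is «`ρ̄_{E,3}` onto and some additive place of Kodaira type `IV`/`IV*` with `f_v = 2`» (in range 91 of the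
448 deep X11a classes at `3`, cell census `pub/bsd-stepL/line-er5-p2/census/x11a3_kodaira.tsv`). BSD is not proved for
any curve or class by this file. beyond-print theorem: no.

## What

* `levelLowerBound_of_carayolLivne` — the displayed hypothesis `hlow` of the sibling («every good-ordinary member of
  `H(E[3])` has level divisible by `p_v`», `v` an additive place with `p_v ≠ 3`) from the named fact: a member
  (`IsOrdinaryMemberOfLevel W 3 g ι`) is a newform of weight `k > 2` congruent to `E` off `N·M`, a fortiori off `N·M·3`.
* `ClassX11a.missingLowerBoundAt_three_of_kodaira_of_facts` — **AT AN X11a PAIR WITH `p = 3`, `ρ̄_{E,3}` ONTO AND A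
  KODAIRA `IV`/`IV*` PLACE WITH `f_v = 2`: the lower half `Typed.MissingLowerBoundAt W 3` from 25 NAMED PUBLISHED
  FACTS, NOTHING ELSE** (no certificate, no unprinted statement, no displayed hypothesis).
* `memberRatEqAt_three_of_kodaira_of_facts` — the registered stub's conclusion `OddChain.MemberRatEqAt W 3` there,
  from FOUR named facts (modularity, the additive-drop level lowering, S–U's member instance, Carayol–Livné).
* `memberRatEqAtThree_on_kodaira_of_facts` — the `∀`-form: `stub_memberRatEqAtThree` with the extra binders
  «`Surj W p`» and «`∃ v` additive, `3 ∣ #Φ_v(𝔽̄_v)`, `p_v³ ∤ N`» (its `¬ X11a.ShaAnUnit` binder is not needed),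
  from the four facts; `lowerThree_on_kodaira_of_facts` — the same for `Typed.MissingLowerBoundAt` from the 25.

References: [Carayol1986] Thm. (A); [Livne1989]; [DarmonDiamondTaylor1995] Thm. 3.1 (d), p. 87, Thm. 3.15;
[SkinnerUrban2014] Thm. 1 = 3.6.4; [Mazur1978] Cor. 4.1; [EmertonPollackWeston2006] Thm. 5.1.3; sibling
`PrintX11aLowerHalfThreeKodairaMember` (module docstring) and `pub/bsd-stepL/line-er5-p2/P3-LOWER-AUDIT.md` §4–4b.
-/

set_option autoImplicit false
set_option linter.dupNamespace false -- the directory name repeats the summit name (sibling precedent)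

noncomputable section

open scoped Classical MatrixGroups ModularForm

open CongruenceSubgroup UpperHalfPlane WeierstrassCurve IsDedekindDomain Rat.HeightOneSpectrum
open Literature.NumberTheory.EllipticCurves Literature.NumberTheory.EllipticCurves.ModularForms
  Literature.NumberTheory.EllipticCurves.Rank1Residual
  Literature.NumberTheory.EllipticCurves.Rank1Residual.Typed
  Literature.NumberTheory.EllipticCurves.Wuthrich2014
  Literature.NumberTheory.EllipticCurves.SteinWuthrich2013
  Literature.NumberTheory.EllipticCurves.Greenberg1999
  Literature.NumberTheory.EllipticCurves.Kato2004
  Literature.NumberTheory.EllipticCurves.GreenbergVatsal2000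
  Literature.NumberTheory.EllipticCurves.EmertonPollackWeston2006
  Literature.NumberTheory.EllipticCurves.SkinnerUrban2014
  Literature.NumberTheory.GaloisRepresentations
  Literature.NumberTheory.Automorphic
  Summit.BirchSwinnertonDyer.Rank1Residual
  Summit.BirchSwinnertonDyer.Rank1Residual.X1.MuLambda
  Summit.BirchSwinnertonDyer.Rank1Residual.X11a
  Summit.BirchSwinnertonDyer.Rank1Residual.X11a.LambdaNorm
  Summit.BirchSwinnertonDyer.Rank1Residual.X11a.Chain

namespace Summit.BirchSwinnertonDyer.BirchSwinnertonDyer.Theorems.OddChain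

section Pair

variable {W : WeierstrassCurve ℚ} [W.IsElliptic] [W.IsGloballyMinimal] {p : ℕ} [Fact p.Prime]

/-- **The displayed lower bound `hlow` of the sibling from the Carayol–Livné fact**: at an odd prime `p` with `E[p]`
irreducible and an additive place `v` with `p_v ≠ p`, every good-ordinary member `(g, ι)` of `H(E[p])` of level `M`
(`IsOrdinaryMemberOfLevel W p g ι`: a newform of weight `k > 2` with `|ι(a_ℓ(g)) − a_ℓ(E)|_p < 1` for all primes
`ℓ ∤ N·M`) has `p_v ∣ M`. [cite: Carayol1986, Thm. (A)] [cite: Livne1989]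
[cite: DarmonDiamondTaylor1995, Thm. 3.1 (d) and p. 87] -/
theorem levelLowerBound_of_carayolLivne (hCL : carayolLivne_additivePrime_dvd_level_of_congruent_newform)
    (hp2 : p ≠ 2) (hirr : Irr W p) (v : HeightOneSpectrum ℤ) (hadd : W.HasAdditiveReductionAt v)
    (hvp : natGenerator v ≠ p) (M : ℕ) [NeZero M] (k : ℤ) (g : CuspForm (Gamma0 M) k)
    (ι : coeffField g →+* PadicAlgCl p) (hmem : IsOrdinaryMemberOfLevel W p g ι) : natGenerator v ∣ M :=
  hCL W p hp2 hirr v hadd hvp g ι (le_of_lt hmem.1) hmem.2.2.1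
    fun ℓ hℓ hℓNMp ↦ hmem.2.2.2.2 ℓ hℓ fun h ↦ hℓNMp (h.mul_right p)

/-- **AT AN X11a PAIR WITH `p = 3` ON THE KODAIRA SUB-LOCUS: the lower half `Typed.MissingLowerBoundAt W p` FROM 25
NAMED PUBLISHED FACTS, NOTHING ELSE.** Inputs per pair: `ClassX11a W 3`, `Surj W 3`, a place `v` of additive reduction
with `3 ∣ #Φ_v(𝔽̄_v)` (Kodaira `IV`/`IV*`) and `p_v³ ∤ N` — all decidable by Tate's algorithm; facts: the 22 of the
ram-member door p617929 (S–U's member instance FLAGGED `SU14-12.3.6-mu@nonsplit@3`; Mazur's Manin constant), the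
additive-drop level lowering, Carayol–Livné at the additive prime, and modularity (already among the 22). The ram
member is CONSTRUCTED (sibling §1–§3); no certificate, no unprinted statement, no displayed hypothesis. PER PAIR;
CONDITIONAL on the facts (one flagged); closes nothing class-wide by itself.
[cite: SkinnerUrban2014, Thm. 1 (p. 2) = Thm. 3.6.4 (p. 43)] [cite: Mazur1978, Cor. 4.1]
[cite: DarmonDiamondTaylor1995, Thm. 3.15, Lemma 2.7, Thm. 3.1 (d), p. 87] [cite: Carayol1986, Thm. (A)] [cite: Livne1989]
[cite: EmertonPollackWeston2006, Thm. 5.1.3] [cite: Miller2011LMS, Def. 1.1] -/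
theorem _root_.Summit.BirchSwinnertonDyer.Rank1Residual.ClassX11a.missingLowerBoundAt_three_of_kodaira_of_facts
    (hNf : exists_isNewformOf)
    (h311 : thm311_cotorsion_weightK_member_ofLevel_odd) (hT1a : thm1_muAlg_of_weightK_member_ofLevel_odd)
    (hT1b : thm513_transfer_from_weightK_member_of_bdd_ofLevel_odd)
    (h61 : DeligneSerre1974.thm61_exists_adicGaloisRep) (h326 : Hida2000_thm326_ordinary)
    (hKato : kato_charIdeal_dvd_multiplicative_of_surjective)
    (h20 : lemma20_surjective_threeAdic_of_semistable)
    (h12 : Kato2004.thm12_4)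
    (hns : Kato2004.exists_multDivisibilityInputs_nonsplit)
    (hsp : Kato2004.exists_multDivisibilityInputs_split)
    (h15 : thm15_isTorsion_multiplicative_rat)
    (h18 : Wuthrich2014.corollary18_padicLFunction_mem_iwasawaAlgebra_multiplicative)
    (hfine : Kato2004.exists_multDivisibilityInputs_fine)
    (hJs : thm61_splitMultiplicative) (hJn : thm61_nonsplitMultiplicative)
    (hGZK : rank_eq_analyticRank_of_analyticRank_le_one)
    (hGS : greenberg_stevens (W := W) (p := p))
    (hMz : mazur_not_dvd_maninConstant_of_odd)
    (hSU : thm364_rational_weightK_member_of_bdd_ofLevel_ram)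
    (hRk : ribet1990_levelLowering_gamma0_newform_at_three_additiveDrop)
    (hCL : carayolLivne_additivePrime_dvd_level_of_congruent_newform)
    (hX : ClassX11a W p) (hp3 : p = 3) (hsurj : Surj W p)
    (v : HeightOneSpectrum ℤ) (hadd : W.HasAdditiveReductionAt v)
    (h3Φ : 3 ∣ (W.kodairaSymbolAt v).componentGroupOrder) (hf2 : ¬ natGenerator v ^ 3 ∣ W.conductorNorm ℤ) :
    MissingLowerBoundAt W p := by
  -- `p ∥ N` at the multiplicative prime `p`, while `p_v² ∣ N`: so `p_v ≠ p`
  have hvp : natGenerator v ≠ p := by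
    rintro hv
    have h2 : natGenerator v ^ 2 ∣ W.conductorNorm ℤ := (natGenerator_sq_dvd_conductorNorm_iff v W).mpr hadd
    have hN0 : W.conductorNorm ℤ ≠ 0 := (W.conductorNorm_pos_holds).ne'
    have hfac := W.factorization_conductorNorm_eq_one_of_hasMultiplicativeReductionAtPrime p hX.mult
    have := ((Fact.out : p.Prime).pow_dvd_iff_le_factorization hN0).mp (hv ▸ h2)
    omega
  exact hX.missingLowerBoundAt_three_of_kodaira_of_levelLowerBound_of_facts hNf h311 hT1a hT1b h61 h326 hKato h20 h12
    hns hsp h15 h18 hfine hJs hJn hGZK hGS hMz hSU hRk hp3 hsurj v hadd h3Φ hf2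
    (fun M _ k g ι hmem ↦ levelLowerBound_of_carayolLivne hCL hX.ne_two hX.irr v hadd hvp M k g ι hmem)

/-- **The registered stub's conclusion `OddChain.MemberRatEqAt W p` AT AN X11a PAIR WITH `p = 3` ON THE KODAIRA
SUB-LOCUS, from FOUR named facts** — modularity `hNf`, the additive-drop level lowering `hRk`, Skinner–Urban's member
instance `hSU` (FLAG `SU14-12.3.6-mu@nonsplit@3` at `p = 3`) and the Carayol–Livné lower bound `hCL` — and NOTHING
ELSE. PER PAIR; CONDITIONAL; closes nothing class-wide. [cite: SkinnerUrban2014, Thm. 1 (p. 2) = Thm. 3.6.4 (p. 43)]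
[cite: DarmonDiamondTaylor1995, Thm. 3.15, Thm. 3.1 (d), p. 87] [cite: Carayol1986, Thm. (A)] [cite: Livne1989] -/
theorem memberRatEqAt_three_of_kodaira_of_facts
    (hNf : exists_isNewformOf) (hRk : ribet1990_levelLowering_gamma0_newform_at_three_additiveDrop)
    (hSU : thm364_rational_weightK_member_of_bdd_ofLevel_ram)
    (hCL : carayolLivne_additivePrime_dvd_level_of_congruent_newform)
    (hX : ClassX11a W p) (hp3 : p = 3) (hsurj : Surj W p)
    (v : HeightOneSpectrum ℤ) (hadd : W.HasAdditiveReductionAt v)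
    (h3Φ : 3 ∣ (W.kodairaSymbolAt v).componentGroupOrder) (hf2 : ¬ natGenerator v ^ 3 ∣ W.conductorNorm ℤ) :
    MemberRatEqAt W p := by
  have hvp : natGenerator v ≠ p := by
    rintro hv
    have h2 : natGenerator v ^ 2 ∣ W.conductorNorm ℤ := (natGenerator_sq_dvd_conductorNorm_iff v W).mpr hadd
    have hN0 : W.conductorNorm ℤ ≠ 0 := (W.conductorNorm_pos_holds).ne'
    have hfac := W.factorization_conductorNorm_eq_one_of_hasMultiplicativeReductionAtPrime p hX.mult
    have := ((Fact.out : p.Prime).pow_dvd_iff_le_factorization hN0).mp (hv ▸ h2)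
    omega
  exact memberRatEqAt_three_of_kodaira_of_levelLowerBound_of_su hNf hRk hSU hX hp3 hsurj v hadd h3Φ hf2
    (fun M _ k g ι hmem ↦ levelLowerBound_of_carayolLivne hCL hX.ne_two hX.irr v hadd hvp M k g ι hmem)

end Pair

/-! ### The `∀`-forms: the registered stub ∕ the lower half RESTRICTED to the Kodaira sub-locus, facts only -/

section SubLocus

/-- **`stub_memberRatEqAtThree` RESTRICTED TO THE KODAIRA SUB-LOCUS, from FOUR named published facts and NOTHING
ELSE**: for every X11a pair with `p = 3`, `ρ̄_{E,3}` onto, and a place of additive reduction of Kodaira type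
`IV`/`IV*` with `f_v = 2`, `OddChain.MemberRatEqAt W p` holds — granted modularity, the additive-drop level
lowering, Skinner–Urban's member instance (flagged at `3`) and Carayol–Livné. (The stub's binder `¬ X11a.ShaAnUnit`
is not needed.) The remaining content of the stub is `MemberRatEqAt W 3` OFF this sub-locus — Wan's Thm. 4 at
`p = 3` for one weight-`k > 2` member, not in print. CONDITIONAL; closes nothing by itself.
[cite: SkinnerUrban2014, Thm. 1 (p. 2) = Thm. 3.6.4 (p. 43)] [cite: DarmonDiamondTaylor1995, Thm. 3.15, Thm. 3.1 (d)]
[cite: Wan2015, Thm. 4 (p. 4)] -/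
theorem memberRatEqAtThree_on_kodaira_of_facts
    (hNf : exists_isNewformOf) (hRk : ribet1990_levelLowering_gamma0_newform_at_three_additiveDrop)
    (hSU : thm364_rational_weightK_member_of_bdd_ofLevel_ram)
    (hCL : carayolLivne_additivePrime_dvd_level_of_congruent_newform) :
    ∀ (W : WeierstrassCurve ℚ) [W.IsElliptic] [W.IsGloballyMinimal] (p : ℕ) [Fact p.Prime],
      ClassX11a W p → p = 3 → Surj W p →
      (∃ v : HeightOneSpectrum ℤ, W.HasAdditiveReductionAt v ∧ 3 ∣ (W.kodairaSymbolAt v).componentGroupOrder ∧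
        ¬ natGenerator v ^ 3 ∣ W.conductorNorm ℤ) →
      MemberRatEqAt W p :=
  fun _ _ _ _ _ hX hp3 hsurj ⟨v, hadd, h3Φ, hf2⟩ =>
    memberRatEqAt_three_of_kodaira_of_facts hNf hRk hSU hCL hX hp3 hsurj v hadd h3Φ hf2

/-- **The lower half `Typed.MissingLowerBoundAt` ON THE KODAIRA SUB-LOCUS of the X11a pairs at `3`, from 25 named
published facts + Greenberg–Stevens, NOTHING ELSE** (no certificate, no unprinted statement): `∀`-form of
`ClassX11a.missingLowerBoundAt_three_of_kodaira_of_facts`. CONDITIONAL (one fact flagged at `3`); closes nothing by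
itself. [cite: SkinnerUrban2014, Thm. 1 (p. 2) = Thm. 3.6.4 (p. 43)] [cite: Mazur1978, Cor. 4.1]
[cite: DarmonDiamondTaylor1995, Thm. 3.15, Thm. 3.1 (d)] [cite: Miller2011LMS, Def. 1.1] -/
theorem lowerThree_on_kodaira_of_facts
    (hNf : exists_isNewformOf)
    (h311 : thm311_cotorsion_weightK_member_ofLevel_odd) (hT1a : thm1_muAlg_of_weightK_member_ofLevel_odd)
    (hT1b : thm513_transfer_from_weightK_member_of_bdd_ofLevel_odd)
    (h61 : DeligneSerre1974.thm61_exists_adicGaloisRep) (h326 : Hida2000_thm326_ordinary)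
    (hKato : kato_charIdeal_dvd_multiplicative_of_surjective)
    (h20 : lemma20_surjective_threeAdic_of_semistable)
    (h12 : Kato2004.thm12_4)
    (hns : Kato2004.exists_multDivisibilityInputs_nonsplit)
    (hsp : Kato2004.exists_multDivisibilityInputs_split)
    (h15 : thm15_isTorsion_multiplicative_rat)
    (h18 : Wuthrich2014.corollary18_padicLFunction_mem_iwasawaAlgebra_multiplicative)
    (hfine : Kato2004.exists_multDivisibilityInputs_fine)
    (hJs : thm61_splitMultiplicative) (hJn : thm61_nonsplitMultiplicative)
    (hGZK : rank_eq_analyticRank_of_analyticRank_le_one)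
    (hGS : ∀ (W : WeierstrassCurve ℚ) [W.IsElliptic] [W.IsGloballyMinimal] (p : ℕ) [Fact p.Prime],
      greenberg_stevens (W := W) (p := p))
    (hMz : mazur_not_dvd_maninConstant_of_odd)
    (hSU : thm364_rational_weightK_member_of_bdd_ofLevel_ram)
    (hRk : ribet1990_levelLowering_gamma0_newform_at_three_additiveDrop)
    (hCL : carayolLivne_additivePrime_dvd_level_of_congruent_newform) :
    ∀ (W : WeierstrassCurve ℚ) [W.IsElliptic] [W.IsGloballyMinimal] (p : ℕ) [Fact p.Prime],
      ClassX11a W p → p = 3 → Surj W p →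
      (∃ v : HeightOneSpectrum ℤ, W.HasAdditiveReductionAt v ∧ 3 ∣ (W.kodairaSymbolAt v).componentGroupOrder ∧
        ¬ natGenerator v ^ 3 ∣ W.conductorNorm ℤ) →
      MissingLowerBoundAt W p :=
  fun W _ _ p _ hX hp3 hsurj ⟨v, hadd, h3Φ, hf2⟩ =>
    hX.missingLowerBoundAt_three_of_kodaira_of_facts hNf h311 hT1a hT1b h61 h326 hKato h20 h12 hns hsp h15 h18 hfine
      hJs hJn hGZK (hGS W p) hMz hSU hRk hCL hp3 hsurj v hadd h3Φ hf2

/-- **The registered stub `stub_memberRatEqAtThree` (VERBATIM signature) from the four named facts and ONE displayed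
statement: `OddChain.MemberRatEqAt W 3` OFF the Kodaira sub-locus** (`hoff`: at the deep X11a pairs with `p = 3` that are
NOT «`ρ̄_{E,3}` onto with an additive place of Kodaira type `IV`/`IV*` and `f_v = 2`» — in range 357 of 448 deep classes,
incl. all 11 non-surjective ones; NOT in print: Wan's Thm. 4 at `p = 3`). Turnkey for a reshape of the line's skeleton
(`stub_memberRatEqAtThree` ↦ Kodaira part CLOSED here + off-Kodaira part OPEN). CONDITIONAL; closes nothing by itself.
[cite: Wan2015, Thm. 4 (p. 4)] [cite: SkinnerUrban2014, Thm. 1 (p. 2) = Thm. 3.6.4 (p. 43)] [cite: DarmonDiamondTaylor1995, Thm. 3.15] -/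
theorem memberRatEqAtThree_of_offKodaira_of_facts
    (hNf : exists_isNewformOf) (hRk : ribet1990_levelLowering_gamma0_newform_at_three_additiveDrop)
    (hSU : thm364_rational_weightK_member_of_bdd_ofLevel_ram)
    (hCL : carayolLivne_additivePrime_dvd_level_of_congruent_newform)
    (hoff : ∀ (W : WeierstrassCurve ℚ) [W.IsElliptic] [W.IsGloballyMinimal] (p : ℕ) [Fact p.Prime],
      ClassX11a W p → p = 3 → ¬ X11a.ShaAnUnit W p →
      ¬ (Surj W p ∧ ∃ v : HeightOneSpectrum ℤ, W.HasAdditiveReductionAt v ∧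
          3 ∣ (W.kodairaSymbolAt v).componentGroupOrder ∧ ¬ natGenerator v ^ 3 ∣ W.conductorNorm ℤ) →
      MemberRatEqAt W p) :
    ∀ (W : WeierstrassCurve ℚ) [W.IsElliptic] [W.IsGloballyMinimal] (p : ℕ) [Fact p.Prime],
      ClassX11a W p → p = 3 → ¬ X11a.ShaAnUnit W p → MemberRatEqAt W p := by
  intro W _ _ p _ hX hp3 hdeep
  by_cases hK : Surj W p ∧ ∃ v : HeightOneSpectrum ℤ, W.HasAdditiveReductionAt v ∧
      3 ∣ (W.kodairaSymbolAt v).componentGroupOrder ∧ ¬ natGenerator v ^ 3 ∣ W.conductorNorm ℤ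
  · exact memberRatEqAtThree_on_kodaira_of_facts hNf hRk hSU hCL W p hX hp3 hK.1 hK.2
  · exact hoff W p hX hp3 hdeep hK

end SubLocus

end Summit.BirchSwinnertonDyer.BirchSwinnertonDyer.Theorems.OddChain

end
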